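import Summits.BirchSwinnertonDyer.BirchSwinnertonDyer.Theorems.GenusKolyvaginAtTwoMinimalTwinBSDTwoKrizLiAnchor219a1
import Literature.NumberTheory.EllipticCurves.Curve37aRootNumber
import HarnessLib

/-!
# Route `GenusKolyvaginAtTwo`, crux U₂ `MinimalTwinBSDTwo` (stmt-BirchSwinnertonDyer-22985), LINE 23 «twin_swap»: THE ROOT NUMBER OF THE RANK-ONE ANCHOR `219a1`
# IS `−1` IN THE KERNEL (NON-split multiplicative reduction at every bad prime: `N = 219 = 3·73`), HENCE `ord_{s=1} L(219a1, s) = 1` MODULO MODULARITY +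
# Kriz–Li Thm 4.3 — the Gross–Zagier–Kolyvagin input (`rank_eq_analyticRank_of_analyticRank_le_one`) of the road `…KrizLiAnchor219a1.lean` DISCHARGED

Seat `bsd-line-gk2-p2` g36 (PROVER 2/3, cell `bsd-f1-sign2`; LINE 23 holder), `--supports stmt-BirchSwinnertonDyer-22985` (helper; closes nothing).
THEOREMS ONLY (0 `def`, 0 `sorry`); standard axioms.  HONEST FRAMING (D-0014/D-0036): method and lemma names of the tree's `Literature/…/Curve37aRootNumber.lean`
(non-split place) and of this seat's `…KrizLiAnchor43a1RootNumber.lean` (g36), transplanted to Cremona's `219A1` (`(⟨0, -1, 1, -6, 8⟩ : WeierstrassCurve ℚ)`, `Δ = -219`, `c₄ = 304`, `N = 219`):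
away from `219` the discriminant is a `v`-unit (good reduction, `W_v = +1`); at each place `v` above a bad prime `p ∈ {3, 73}`, `c₄ = 304` is a `v`-unit and
`v(Δ) < 1` (multiplicative reduction), and the node-tangent quadratic `c₄T² + a₁c₄T − (54b₆ − 3b₂b₄ + a₂c₄) = 304T² − (1334)` of the integral model has NO root in
`κ(O_v) = 𝔽_p` (a root `r` would make `(c₄r)² = c₄·(1334) = 405536` a square mod `p`, but the Jacobi symbol `(405536 | p) = −1` at every bad `p`) — NON-split, `W_p = +1`
(Rohrlich); so the algebraic root number `−∏_v W_v = −1`, and by the Modularity Theorem (`exists_isNewformOf`) with the tree's PROVED Atkin–Lehner comparison at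
squarefree conductor (`rootNumber_eq_algebraicRootNumber_of_squarefree`) `w(219a1) = −1`; parity (`odd_analyticRank_of_rootNumber_eq_neg_one`) makes `r_an` odd and
Kriz–Li Thm 4.3 with the Table-1 (★)-datum caps it at `1`: **`r_an(219a1) = 1`** with NO Gross–Zagier–Kolyvagin input (§3).  §4 re-issues the road theorems of
`…KrizLiAnchor219a1.lean` with `hmod` in place of `hGZK`.  **BSD is NOT proved by any of this; U₂ is NOT proved; the wall rows stay displayed; no item is closed.**

References: [CremonaAlgorithms1997] Table 1 (curve 219A1: `r = 1`), §2.11; [SilvermanAEC2009] VII.5 Prop. 5.1, C.16 Thm. 16.3; [Rohrlich1993Compositio] Prop. 2;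
[KrizLi2019] Thm 4.3, §6 Table 1 (row 219a1); [BCDTJAMS2001] Thm. A; [KellockDokchitser2023] Cor. 2.5.
-/

set_option autoImplicit false
-- the Theorems namespace of this sub repeats the summit name by design (D-0017 nested layout)
set_option linter.dupNamespace false

noncomputable section

open scoped Classical NumberField

open WeierstrassCurve IsDedekindDomain Rat.HeightOneSpectrum NumberField Literature.NumberTheory.EllipticCurves
  Literature.NumberTheory.EllipticCurves.ModularForms
  Literature.NumberTheory.EllipticCurves.Rank1Residual
  Literature.NumberTheory.EllipticCurves.Rank1Residual.Typed
  Literature.NumberTheory.DiophantineGeometry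
  Summit.BirchSwinnertonDyer
  Summit.BirchSwinnertonDyer.Rank1Residual
  Summit.BirchSwinnertonDyer.Rank1Residual.X11b
  Summit.BirchSwinnertonDyer.Rank1Residual.X5.O1
  Summit.BirchSwinnertonDyer.Rank1Residual.P2
  Summit.BirchSwinnertonDyer.BirchSwinnertonDyer.Rank1Residual.IntModel
  Summit.BirchSwinnertonDyer.BirchSwinnertonDyer.Theorems
  Summit.BirchSwinnertonDyer.BirchSwinnertonDyer.Theorems.AddPotGoodPrint
  Summit.BirchSwinnertonDyer.BirchSwinnertonDyer.Theorems.GenusExact.TwinSwap.KrizLiAnchorWall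
open IsDedekindDomain.HeightOneSpectrum Polynomial

namespace Summit.BirchSwinnertonDyer.BirchSwinnertonDyer.Theorems.GenusExact.TwinSwap.KrizLiAnchor219a1

/-! ## §1 Invariants of the equation over `ℚ` -/
section Invariants219A1RN

/-- `Δ(219a1) = -219` (rational model). [cite: CremonaAlgorithms1997, Table 1 (219A1)] -/
theorem Δ_219A1_rat : (⟨0, -1, 1, -6, 8⟩ : WeierstrassCurve ℚ).Δ = -219 := by
  norm_num [WeierstrassCurve.Δ, WeierstrassCurve.b₂, WeierstrassCurve.b₄, WeierstrassCurve.b₆, WeierstrassCurve.b₈]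

/-- `c₄(219a1) = 304` (rational model). [cite: CremonaAlgorithms1997, Table 1 (219A1)] -/
theorem c₄_219A1_rat : (⟨0, -1, 1, -6, 8⟩ : WeierstrassCurve ℚ).c₄ = 304 := by
  norm_num [WeierstrassCurve.c₄, WeierstrassCurve.b₂, WeierstrassCurve.b₄]

/-- `219a1` is integral at every finite place of `ℤ`. [cite: SilvermanAEC2009, VIII.8] -/
theorem isIntegralAt_219A1 (v : HeightOneSpectrum ℤ) : (⟨0, -1, 1, -6, 8⟩ : WeierstrassCurve ℚ).IsIntegralAt v := by
  rw [isIntegralAt_iff_valuation_le_one]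
  refine ⟨?_, ?_, ?_, ?_, ?_⟩
  · simp
  · simp
  · simp
  · simpa using v.valuation_le_one (K := ℚ) (-6 : ℤ)
  · simpa using v.valuation_le_one (K := ℚ) (8 : ℤ)

end Invariants219A1RN

/-! ## §2 Local root numbers: `+1` everywhere (good away from `219`, NON-split multiplicative above each bad prime); algebraic root number `−1` -/
section LocalRootNumbers219A1

/-- At a place `v` with `v(Δ) = 1` (`v ∤ 219`) the curve has good reduction, so `W_v = 1`. [cite: Rohrlich1993Compositio, Prop. 2(i)] -/
theorem localRootNumberAt_of_valuation_Δ_eq_one_219A1 (v : HeightOneSpectrum ℤ)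
    (h : v.valuation ℚ (⟨0, -1, 1, -6, 8⟩ : WeierstrassCurve ℚ).Δ = 1) :
    haveI := isElliptic_219A1
    (⟨0, -1, 1, -6, 8⟩ : WeierstrassCurve ℚ).localRootNumberAt v = 1 :=
  haveI := isElliptic_219A1
  WeierstrassCurve.localRootNumberAt_of_hasGoodReductionAt
    (hasGoodReductionAt_of_valuation_Δ_eq_one_holds v _ (isIntegralAt_219A1 v) h)

/-- If `v(Δ) < 1` then `v` lies above `3` or `73` (`Δ = -219 = −3·73`). [folklore] -/
theorem mem_of_valuation_Δ_lt_one_219A1 {v : HeightOneSpectrum ℤ}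
    (h : v.valuation ℚ (⟨0, -1, 1, -6, 8⟩ : WeierstrassCurve ℚ).Δ < 1) : (3 : ℤ) ∈ v.asIdeal ∨ (73 : ℤ) ∈ v.asIdeal := by
  rw [Δ_219A1_rat] at h
  have hΔ : (-219 : ℚ) = -(algebraMap ℤ ℚ 3 * algebraMap ℤ ℚ 73) := by norm_num
  rw [hΔ, Valuation.map_neg, Valuation.map_mul] at h
  by_contra hcon
  push Not at hcon
  have h1 : v.valuation ℚ (algebraMap ℤ ℚ 3) = 1 :=
    le_antisymm (v.valuation_le_one (3 : ℤ)) (not_lt.mp fun hlt => hcon.1 ((v.valuation_lt_one_iff_mem (3 : ℤ)).mp hlt))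
  have h2 : v.valuation ℚ (algebraMap ℤ ℚ 73) = 1 :=
    le_antisymm (v.valuation_le_one (73 : ℤ)) (not_lt.mp fun hlt => hcon.2 ((v.valuation_lt_one_iff_mem (73 : ℤ)).mp hlt))
  rw [h1, h2, one_mul] at h
  exact lt_irrefl _ h

/-- At a place `v` with `304 ∉ v`, `c₄ = 304` is a `v`-unit. [cite: SilvermanAEC2009, VII.5 Prop. 5.1(b)] -/
theorem valuation_c₄_eq_one_219A1_of {v : HeightOneSpectrum ℤ} (hc : (304 : ℤ) ∉ v.asIdeal) :
    v.valuation ℚ (⟨0, -1, 1, -6, 8⟩ : WeierstrassCurve ℚ).c₄ = 1 := by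
  rw [c₄_219A1_rat]
  by_contra h
  have h' : v.valuation ℚ (algebraMap ℤ ℚ 304) ≠ 1 := by simpa using h
  have hlt := lt_of_le_of_ne (v.valuation_le_one (304 : ℤ)) h'
  exact hc ((v.valuation_lt_one_iff_mem (304 : ℤ)).mp hlt)

/-- `304 ∉ v` when `3 ∈ v` (Bezout: `(-101)·3 + (1)·304 = 1`). [folklore] -/
theorem not_mem_c₄_219A1_3 {v : HeightOneSpectrum ℤ} (hp : (3 : ℤ) ∈ v.asIdeal) :
    (304 : ℤ) ∉ v.asIdeal := by
  intro hc
  have hone : (1 : ℤ) ∈ v.asIdeal := by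
    have := v.asIdeal.add_mem (v.asIdeal.mul_mem_left (-101) hp) (v.asIdeal.mul_mem_left (1) hc)
    convert this using 1
    norm_num
  exact v.isPrime.ne_top ((Ideal.eq_top_iff_one _).mpr hone)

/-- At a place above `3`, `c₄ = 304` is a `v`-unit. [cite: SilvermanAEC2009, VII.5 Prop. 5.1(b)] -/
theorem valuation_c₄_eq_one_219A1_3 {v : HeightOneSpectrum ℤ} (hp : (3 : ℤ) ∈ v.asIdeal) :
    v.valuation ℚ (⟨0, -1, 1, -6, 8⟩ : WeierstrassCurve ℚ).c₄ = 1 :=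
  valuation_c₄_eq_one_219A1_of (not_mem_c₄_219A1_3 hp)

/-- The arithmetic heart at `3`: if `3 ∈ v` and `304·r² − (1334) ∈ v` for an integer `r`, then `405536 = 304·(1334) = (304r)²` is a square in `ZMod 3` — impossible,
the Jacobi symbol `(405536 | 3)` being `−1`. [folklore] -/
theorem no_int_root_219A1_3 {v : HeightOneSpectrum ℤ} (hp : (3 : ℤ) ∈ v.asIdeal) (r : ℤ)
    (hr : 304 * r ^ 2 + (-1334) ∈ v.asIdeal) : False := by
  have hdvd : (3 : ℤ) ∣ 304 * r ^ 2 + (-1334) := by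
    by_contra hnd
    have hP : Prime (3 : ℤ) := Int.prime_iff_natAbs_prime.mpr (by norm_num)
    obtain ⟨a, b, hab⟩ := (hP.coprime_iff_not_dvd).mpr hnd
    have hone : (1 : ℤ) ∈ v.asIdeal := by
      rw [← hab]
      exact v.asIdeal.add_mem (v.asIdeal.mul_mem_left a hp) (v.asIdeal.mul_mem_left b hr)
    exact v.isPrime.ne_top ((Ideal.eq_top_iff_one _).mpr hone)
  have hz : ((304 * r ^ 2 + (-1334) : ℤ) : ZMod 3) = 0 :=
    (ZMod.intCast_zmod_eq_zero_iff_dvd _ 3).mpr (by exact_mod_cast hdvd)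
  push_cast at hz
  have hsq : IsSquare ((405536 : ℤ) : ZMod 3) := by
    refine ⟨((304 * r : ℤ) : ZMod 3), ?_⟩
    push_cast
    linear_combination (-304 : ZMod 3) * hz
  exact ZMod.nonsquare_of_jacobiSym_eq_neg_one (a := 405536) (b := 3) (by norm_num) hsq

/-- `304 ∉ v` when `73 ∈ v` (Bezout: `(25)·73 + (-6)·304 = 1`). [folklore] -/
theorem not_mem_c₄_219A1_73 {v : HeightOneSpectrum ℤ} (hp : (73 : ℤ) ∈ v.asIdeal) :
    (304 : ℤ) ∉ v.asIdeal := by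
  intro hc
  have hone : (1 : ℤ) ∈ v.asIdeal := by
    have := v.asIdeal.add_mem (v.asIdeal.mul_mem_left (25) hp) (v.asIdeal.mul_mem_left (-6) hc)
    convert this using 1
    norm_num
  exact v.isPrime.ne_top ((Ideal.eq_top_iff_one _).mpr hone)

/-- At a place above `73`, `c₄ = 304` is a `v`-unit. [cite: SilvermanAEC2009, VII.5 Prop. 5.1(b)] -/
theorem valuation_c₄_eq_one_219A1_73 {v : HeightOneSpectrum ℤ} (hp : (73 : ℤ) ∈ v.asIdeal) :
    v.valuation ℚ (⟨0, -1, 1, -6, 8⟩ : WeierstrassCurve ℚ).c₄ = 1 :=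
  valuation_c₄_eq_one_219A1_of (not_mem_c₄_219A1_73 hp)

/-- The arithmetic heart at `73`: if `73 ∈ v` and `304·r² − (1334) ∈ v` for an integer `r`, then `405536 = 304·(1334) = (304r)²` is a square in `ZMod 73` — impossible,
the Jacobi symbol `(405536 | 73)` being `−1`. [folklore] -/
theorem no_int_root_219A1_73 {v : HeightOneSpectrum ℤ} (hp : (73 : ℤ) ∈ v.asIdeal) (r : ℤ)
    (hr : 304 * r ^ 2 + (-1334) ∈ v.asIdeal) : False := by
  have hdvd : (73 : ℤ) ∣ 304 * r ^ 2 + (-1334) := by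
    by_contra hnd
    have hP : Prime (73 : ℤ) := Int.prime_iff_natAbs_prime.mpr (by norm_num)
    obtain ⟨a, b, hab⟩ := (hP.coprime_iff_not_dvd).mpr hnd
    have hone : (1 : ℤ) ∈ v.asIdeal := by
      rw [← hab]
      exact v.asIdeal.add_mem (v.asIdeal.mul_mem_left a hp) (v.asIdeal.mul_mem_left b hr)
    exact v.isPrime.ne_top ((Ideal.eq_top_iff_one _).mpr hone)
  have hz : ((304 * r ^ 2 + (-1334) : ℤ) : ZMod 73) = 0 :=
    (ZMod.intCast_zmod_eq_zero_iff_dvd _ 73).mpr (by exact_mod_cast hdvd)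
  push_cast at hz
  have hsq : IsSquare ((405536 : ℤ) : ZMod 73) := by
    refine ⟨((304 * r : ℤ) : ZMod 73), ?_⟩
    push_cast
    linear_combination (-304 : ZMod 73) * hz
  exact ZMod.nonsquare_of_jacobiSym_eq_neg_one (a := 405536) (b := 73) (by norm_num) hsq

/-- **The non-split mechanism for `219a1`**: at a place `v` where `c₄ = 304` is a unit and the integer quadratic `304 r² − (1334)` has no root modulo `v`, the chosen
local minimal model is NOT split multiplicative — the node-tangent quadratic `c₄T² + a₁c₄T − (54b₆ − 3b₂b₄ + a₂c₄) = 304 T² − (1334)` of the integral model would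
have a root in `κ(O_v)`, which lifts to an integer root modulo `v`. [cite: CremonaAlgorithms1997, §2.11] [cite: SilvermanAEC2009, VII.5 Prop. 5.1(b)] -/
theorem not_hasSplitMultiplicativeReductionAt_219A1_of {v : HeightOneSpectrum ℤ} (hc : (304 : ℤ) ∉ v.asIdeal)
    (hroot : ∀ r : ℤ, (304 * r ^ 2 + (-1334) : ℤ) ∈ v.asIdeal → False) :
    haveI := isElliptic_219A1
    ¬ (⟨0, -1, 1, -6, 8⟩ : WeierstrassCurve ℚ).HasSplitMultiplicativeReductionAt v := by
  haveI := isElliptic_219A1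
  have hc₄ := valuation_c₄_eq_one_219A1_of hc
  have hW := isIntegralAt_219A1 v
  set O := v.adicCompletionIntegers ℚ with hO
  set K := v.adicCompletion ℚ with hK
  set EK := (⟨0, -1, 1, -6, 8⟩ : WeierstrassCurve ℚ).baseChange K with hEK
  haveI hmin : EK.IsMinimal O :=
    isMinimalAt_of_lt_valuation_c₄ hW
      (by rw [hc₄, ← WithZero.exp_zero]; exact WithZero.exp_lt_exp.mpr (by norm_num))
  haveI : EK.IsElliptic := by rw [hEK, WeierstrassCurve.baseChange]; infer_instance
  obtain ⟨Dv, hD⟩ : ∃ Dv : VariableChange K, (⟨0, -1, 1, -6, 8⟩ : WeierstrassCurve ℚ).localMinimalModel v = Dv • EK := ⟨_, rfl⟩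
  unfold WeierstrassCurve.HasSplitMultiplicativeReductionAt
  rw [hasSplitMultiplicativeReduction_iff_of_isMinimal_of_eq_smul O hD EK.isUnit_Δ.ne_zero,
    hasSplitMultiplicativeReduction_iff]
  intro hS
  obtain ⟨hm, hsplit⟩ := hS
  -- the integral model of `EK = E ⊗ K_v` has the integer coefficients of `E`
  have inj := IsFractionRing.injective O K
  have hc4 : (EK.integralModel O).c₄ = 304 := inj <| by
    rw [integralModel_c₄_eq, map_ofNat, hEK, WeierstrassCurve.baseChange, map_c₄]; rw [c₄_219A1_rat]; norm_num
  have ha1 : (EK.integralModel O).a₁ = 0 := inj <| by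
    rw [integralModel_a₁_eq, map_zero, hEK, WeierstrassCurve.baseChange, map_a₁]; simp
  have ha2 : (EK.integralModel O).a₂ = -1 := inj <| by
    rw [integralModel_a₂_eq, map_neg, map_one, hEK, WeierstrassCurve.baseChange, map_a₂]; norm_num
  have hb2 : (EK.integralModel O).b₂ = -4 := inj <| by
    rw [integralModel_b₂_eq, map_neg, map_ofNat, hEK, WeierstrassCurve.baseChange, map_b₂]; norm_num [WeierstrassCurve.b₂]
  have hb4 : (EK.integralModel O).b₄ = -12 := inj <| by
    rw [integralModel_b₄_eq, map_neg, map_ofNat, hEK, WeierstrassCurve.baseChange, map_b₄]; norm_num [WeierstrassCurve.b₄]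
  have hb6 : (EK.integralModel O).b₆ = 33 := inj <| by
    rw [integralModel_b₆_eq, map_ofNat, hEK, WeierstrassCurve.baseChange, map_b₆]; norm_num [WeierstrassCurve.b₆]
  rw [hc4, ha1, ha2, hb2, hb4, hb6] at hsplit
  -- the node-tangent quadratic over `κ(O_v)` is `304 T² − (1334)`
  set φ : O →+* IsLocalRing.ResidueField O := algebraMap O (IsLocalRing.ResidueField O) with hφ
  have hC4 : (304 : IsLocalRing.ResidueField O) ≠ 0 := by
    intro h0
    have : ((IsLocalRing.residue O).comp (algebraMap ℤ O)) 304 = 0 := by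
      rw [RingHom.comp_apply, map_ofNat, map_ofNat]; exact h0
    have hmem : (304 : ℤ) ∈ v.asIdeal := by
      rw [← ker_residue_comp_algebraMap ℚ v]; exact this
    exact hc hmem
  have hpoly : Polynomial.map φ (C (304 : O) * X ^ 2 + C (0 * 304) * X - C (54 * 33 - 3 * -4 * -12 + -1 * 304)) =
      C (304 : IsLocalRing.ResidueField O) * X ^ 2 + C (0 : IsLocalRing.ResidueField O) * X
        + C (-1334 : IsLocalRing.ResidueField O) := by
    simp only [Polynomial.map_sub, Polynomial.map_add, Polynomial.map_mul, Polynomial.map_pow, Polynomial.map_X, Polynomial.map_ofNat, Polynomial.map_zero, Polynomial.map_one, Polynomial.map_neg, map_mul, map_sub, map_add, map_ofNat, map_zero, map_one, map_neg]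
    ring
  rw [hpoly] at hsplit
  have hdeg : (C (304 : IsLocalRing.ResidueField O) * X ^ 2 + C (0 : IsLocalRing.ResidueField O) * X
        + C (-1334 : IsLocalRing.ResidueField O)).degree ≠ 0 := by
    rw [degree_quadratic hC4]; decide
  obtain ⟨t, ht⟩ := hsplit.exists_eval_eq_zero hdeg
  simp only [eval_add, eval_mul, eval_C, eval_pow, eval_X, zero_mul, add_zero] at ht
  -- lift the root to an integer
  obtain ⟨r, hr⟩ := residue_comp_algebraMap_surjective ℚ v t
  have hι : ((IsLocalRing.residue O).comp (algebraMap ℤ O)) (304 * r ^ 2 + (-1334)) = 0 := by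
    rw [map_add, map_mul, map_pow, hr]
    simp only [map_neg, map_ofNat]
    linear_combination ht
  have hmem : (304 * r ^ 2 + (-1334) : ℤ) ∈ v.asIdeal := by
    rw [← ker_residue_comp_algebraMap ℚ v]; exact hι
  exact hroot r hmem

/-- **NON-split multiplicative reduction above `3`** (`a_3(219a1) = −1`): the quadratic `304 T² − (1334)` has no root mod `3` by the Jacobi symbol. [cite: CremonaAlgorithms1997, Table 1 (219A1)] -/
theorem not_hasSplitMultiplicativeReductionAt_219A1_3 {v : HeightOneSpectrum ℤ} (hp : (3 : ℤ) ∈ v.asIdeal) :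
    haveI := isElliptic_219A1
    ¬ (⟨0, -1, 1, -6, 8⟩ : WeierstrassCurve ℚ).HasSplitMultiplicativeReductionAt v :=
  haveI := isElliptic_219A1
  not_hasSplitMultiplicativeReductionAt_219A1_of (not_mem_c₄_219A1_3 hp) (no_int_root_219A1_3 hp)

/-- **NON-split multiplicative reduction above `73`** (`a_73(219a1) = −1`): the quadratic `304 T² − (1334)` has no root mod `73` by the Jacobi symbol. [cite: CremonaAlgorithms1997, Table 1 (219A1)] -/
theorem not_hasSplitMultiplicativeReductionAt_219A1_73 {v : HeightOneSpectrum ℤ} (hp : (73 : ℤ) ∈ v.asIdeal) :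
    haveI := isElliptic_219A1
    ¬ (⟨0, -1, 1, -6, 8⟩ : WeierstrassCurve ℚ).HasSplitMultiplicativeReductionAt v :=
  haveI := isElliptic_219A1
  not_hasSplitMultiplicativeReductionAt_219A1_of (not_mem_c₄_219A1_73 hp) (no_int_root_219A1_73 hp)

/-- At a place with `v(Δ) < 1`, `c₄` is a `v`-unit. [cite: SilvermanAEC2009, VII.5 Prop. 5.1(b)] -/
theorem valuation_c₄_eq_one_219A1 {v : HeightOneSpectrum ℤ} (h : v.valuation ℚ (⟨0, -1, 1, -6, 8⟩ : WeierstrassCurve ℚ).Δ < 1) :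
    v.valuation ℚ (⟨0, -1, 1, -6, 8⟩ : WeierstrassCurve ℚ).c₄ = 1 := by
  rcases mem_of_valuation_Δ_lt_one_219A1 h with hp | hp
  · exact valuation_c₄_eq_one_219A1_3 hp
  · exact valuation_c₄_eq_one_219A1_73 hp

/-- At a place with `v(Δ) < 1` the reduction is multiplicative (`v(c₄) = 1`). [cite: SilvermanAEC2009, VII.5 Prop. 5.1(b)] -/
theorem hasMultiplicativeReductionAt_219A1 {v : HeightOneSpectrum ℤ} (h : v.valuation ℚ (⟨0, -1, 1, -6, 8⟩ : WeierstrassCurve ℚ).Δ < 1) :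
    haveI := isElliptic_219A1
    (⟨0, -1, 1, -6, 8⟩ : WeierstrassCurve ℚ).HasMultiplicativeReductionAt v :=
  haveI := isElliptic_219A1
  hasMultiplicativeReductionAt_of_valuation_c₄_eq_one (isIntegralAt_219A1 v) (valuation_c₄_eq_one_219A1 h) h

/-- **NON-split multiplicative reduction at every bad place of `219a1`.** [cite: CremonaAlgorithms1997, Table 1 (219A1)] -/
theorem not_hasSplitMultiplicativeReductionAt_219A1 {v : HeightOneSpectrum ℤ} (h : v.valuation ℚ (⟨0, -1, 1, -6, 8⟩ : WeierstrassCurve ℚ).Δ < 1) :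
    haveI := isElliptic_219A1
    ¬ (⟨0, -1, 1, -6, 8⟩ : WeierstrassCurve ℚ).HasSplitMultiplicativeReductionAt v := by
  rcases mem_of_valuation_Δ_lt_one_219A1 h with hp | hp
  · exact not_hasSplitMultiplicativeReductionAt_219A1_3 hp
  · exact not_hasSplitMultiplicativeReductionAt_219A1_73 hp

/-- **Every local root number of `219a1` is `+1`** (good reduction away from `219`, non-split multiplicative above it). [cite: Rohrlich1993Compositio, Prop. 2] -/
theorem localRootNumberAt_219A1 (v : HeightOneSpectrum ℤ) :
    haveI := isElliptic_219A1
    (⟨0, -1, 1, -6, 8⟩ : WeierstrassCurve ℚ).localRootNumberAt v = 1 := by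
  haveI := isElliptic_219A1
  rcases (WeierstrassCurve.valuation_Δ_le_one_of_isIntegralAt (isIntegralAt_219A1 v)).eq_or_lt with h | h
  · exact localRootNumberAt_of_valuation_Δ_eq_one_219A1 v h
  · exact localRootNumberAt_of_hasMultiplicativeReductionAt_of_not_split
      (hasMultiplicativeReductionAt_219A1 h) (not_hasSplitMultiplicativeReductionAt_219A1 h)

/-- **The algebraic root number of `219a1` is `−1`**: `−∏ᶠ_v W_v = −1`, all local factors being `+1` (Cremona Table 1: `219A1` has rank `1`, odd). [cite: CremonaAlgorithms1997, Table 1 (219A1)] -/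
theorem algebraicRootNumber_219A1 :
    haveI := isElliptic_219A1
    (⟨0, -1, 1, -6, 8⟩ : WeierstrassCurve ℚ).algebraicRootNumber = -1 := by
  haveI := isElliptic_219A1
  rw [WeierstrassCurve.algebraicRootNumber, finprod_eq_one_of_forall_eq_one localRootNumberAt_219A1]

end LocalRootNumbers219A1

/-! ## §3 Semistability, `w(219a1) = −1` from modularity, and `r_an(219a1) = 1` -/
section RootNumber219A1

/-- The conductor `N = 219` of `219a1` is squarefree. [cite: CremonaAlgorithms1997, Table 1 (219A1)] -/
theorem squarefree_conductorNorm_219A1 :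
    haveI := isElliptic_219A1
    Squarefree ((⟨0, -1, 1, -6, 8⟩ : WeierstrassCurve ℚ).conductorNorm ℤ) := by
  rw [conductorNorm_219A1]
  rw [show (219 : ℕ) = 3 * 73 by norm_num, Nat.squarefree_mul_iff]
  exact ⟨by norm_num, (show Nat.Prime 3 by norm_num).squarefree, (show Nat.Prime 73 by norm_num).squarefree⟩

/-- **`219a1` is semistable**: good or multiplicative reduction at every finite place. [cite: SilvermanAEC2009, VII.5 Prop. 5.1] -/
theorem isSemistable_219A1 : (⟨0, -1, 1, -6, 8⟩ : WeierstrassCurve ℚ).IsSemistable ℤ := by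
  haveI := isElliptic_219A1
  intro v
  have hint := isIntegralAt_219A1 v
  rcases (WeierstrassCurve.valuation_Δ_le_one_of_isIntegralAt hint).eq_or_lt with h | h
  · exact WeierstrassCurve.isSemistableAt_of_valuation_Δ_eq_one hint h
  · exact WeierstrassCurve.isSemistableAt_of_valuation_c₄_eq_one hint (valuation_c₄_eq_one_219A1 h)

/-- No place of additive reduction. [cite: SilvermanAEC2009, VII.5 Prop. 5.1] -/
theorem not_hasAdditiveReductionAt_219A1 (v : HeightOneSpectrum ℤ) :
    haveI := isElliptic_219A1
    ¬ (⟨0, -1, 1, -6, 8⟩ : WeierstrassCurve ℚ).HasAdditiveReductionAt v :=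
  haveI := isElliptic_219A1
  (WeierstrassCurve.isSemistableAt_iff_not_hasAdditiveReductionAt v _).mp (isSemistable_219A1 v)

/-- **The (analytic) root number of `219a1` is `−1`, from the Modularity Theorem alone** (tree `rootNumber_eq_algebraicRootNumber_of_squarefree`, Atkin–Lehner at
squarefree level). [cite: CremonaAlgorithms1997, Table 1 (219A1)] [cite: BCDTJAMS2001, Thm. A] [cite: KellockDokchitser2023, Cor. 2.5] -/
theorem rootNumber_219A1 (hmod : exists_isNewformOf) :
    haveI := isElliptic_219A1
    (⟨0, -1, 1, -6, 8⟩ : WeierstrassCurve ℚ).rootNumber = -1 := by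
  haveI := isElliptic_219A1
  rw [(WeierstrassCurve.rootNumber_eq_algebraicRootNumber_of_squarefree _ squarefree_conductorNorm_219A1 hmod)
    (fun v h => (not_hasAdditiveReductionAt_219A1 v h).elim), algebraicRootNumber_219A1]

/-- `ord_{s=1} L(219a1, s)` is odd, from the Modularity Theorem alone (`w = −1` and the unconditional half of parity). [cite: SilvermanAEC2009, C.16 Thm. 16.3 and remark, p. 451] -/
theorem odd_analyticRank_219A1 (hmod : exists_isNewformOf) :
    haveI := isElliptic_219A1
    Odd (⟨0, -1, 1, -6, 8⟩ : WeierstrassCurve ℚ).analyticRank :=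
  haveI := isElliptic_219A1
  WeierstrassCurve.odd_analyticRank_of_rootNumber_eq_neg_one (rootNumber_219A1 hmod)

/-- ★ **`ord_{s=1} L(219a1, s) = 1` modulo PRINT + MODULARITY, with NO Gross–Zagier–Kolyvagin input**: odd by `w = −1` (`odd_analyticRank_219A1`) and `≤ 1` by Kriz–Li Thm 4.3 at `d = 1` with the Table-1 (★)-datum (`krizLi_analyticRank_le_one`).  Discharges the `hGZK` of `analyticRank_219A1`: Cremona's `r = 1` for `219A1` as a theorem modulo print + modularity. [cite: CremonaAlgorithms1997, Table 1 (219A1: r = 1)] [cite: KrizLi2019, Thm. 4.3 and §6 Table 1 (row 219a1)] -/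
theorem analyticRank_219A1_of_modularity (h33 : KrizLi2019.thm33_rank_twist) (htab : KrizLi2019.table1_row219a1)
    (hmod : exists_isNewformOf) :
    haveI := isElliptic_219A1
    (⟨0, -1, 1, -6, 8⟩ : WeierstrassCurve ℚ).analyticRank = 1 := by
  haveI := isElliptic_219A1; haveI := isGloballyMinimal_219A1
  haveI : Fact ((-23 : ℤ) < 0) := ⟨by norm_num⟩
  obtain ⟨hIQ, hdisc⟩ := P2.isImaginaryQuadratic_and_discr_of_sq_eq_neg_prime (sqrtField.finrank_eq_two (-23))
    (p := 23) (by norm_num) (by norm_num) (x := sqrtField.r (-23)) (by rw [sqrtField.r_sq']; push_cast; ring)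
  obtain ⟨_, Dt, H, ι, P, j, -, hP, hstar⟩ := htab (sqrtField (-23)) hIQ hdisc
  have hle := krizLi_analyticRank_le_one _ h33 twoTorsion_219A1 (sqrtField (-23)) hIQ (satisfiesHeegnerHypothesis_219A1 hIQ.1 hdisc)
    Dt H ι P hP j hstar
  obtain ⟨k, hk⟩ := odd_analyticRank_219A1 hmod
  omega

end RootNumber219A1

end Summit.BirchSwinnertonDyer.BirchSwinnertonDyer.Theorems.GenusExact.TwinSwap.KrizLiAnchor219a1

end
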